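import Mathlib.Analysis.SpecialFunctions.Pow.Real
import Mathlib.Data.Nat.Totient
import Mathlib.Data.ZMod.Basic
import Mathlib.RingTheory.Coprime.Basic
import HarnessLib

/-!
# Fouvry–Tenenbaum 2021: `τ₂` and `τ₃` in arithmetic progressions beyond `√x`, with classes `mod D`

É. Fouvry, G. Tenenbaum, *Multiplicative functions in large arithmetic progressions and
applications*, Trans. Amer. Math. Soc. 375 (2022) 245–299, doi:10.1090/tran/8442
(`FouvryTenenbaum2021`; held as `paper:doi-10-1090-tran-8442`, Lemmas 4.12–4.13 read on PDF pp. 19–20).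

Companion of `Literature.NumberTheory.Sieve.FouvryTenenbaumLiouville` (Theorems 1.5 and 1.8 for
`f = λ`).  This file vendors the two "algebraic exponential sums" inputs of §4.5, the level of
distribution of `τ₂` (Weil's bound for Kloosterman sums) and of `τ₃` (Friedlander–Iwaniec;
Heath-Brown, Acta Arith. 47 (1986), Thm 1: "any exponent `< 21/41` is admissible") in arithmetic
progressions, with congruence classes `mod D` on each variable ("It is standard to incorporate
these extra characters in the proofs of (4.16) and (4.18)", p. 20), in their UNSIFTED forms (4.16),
(4.18) (the sifted variants (4.17), (4.19) with `𝟙_{Y₀}` are not vendored here).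

## Contents

* `FouvryTenenbaum2021.gAP q a n` — the weight `g_q(n; a) := 1_{n ≡ a (mod q)} − 1_{(n,q)=1}/φ(q)`
  of §1.1 (p. 6: "`Δ_f(x; q, a) = ∑_{n ≤ x} f(n) g_q(n; a)`").
* NAMED FACTS `FouvryTenenbaum2021_lemma412` ((4.16), `τ₂`, level `x^{2/3−ε}`, rendered at the fixed
  admissible exponent `3/5`) and `FouvryTenenbaum2021_lemma413` ((4.18), `τ₃`, level `x^{21/41−ε}`,
  rendered at the fixed admissible exponent `1/2 + 1/85 < 21/41`).  Deep theorems (Weil; Deligne via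
  Heath-Brown); users take them as hypotheses (D-0014).

## Faithfulness (PDF p. 19)

"Lemma 4.12. The following statement holds for suitable, absolute `C₀`. For each `ε > 0`, suitable
`δ = δ(ε), c(ε) > 0`, and uniformly for `x ≥ 1`, `M₁, M₂ ≥ 1`, `Y₀ ≥ 2`, and integers `a, q, t₁, t₂, D`,
such that `2 ≤ Y₀ ≤ x^{1/100} ≤ M₁ ≤ M₂`, `M₁M₂ ≤ x`, `1 ≤ q ≤ x^{2/3−ε}`, `(q, aD) = 1`, `(t₁t₂, D) = 1`,
we have (4.16) `∑_{m₁ ≃ M₁, m₂ ≃ M₂, mᵢ ≡ tᵢ (mod D)} g_q(m₁m₂; a) ≪ D^{C₀} x^{1−δ(ε)}/φ(q)`",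
and Lemma 4.13 likewise with three variables `x^{1/100} ≤ M₁ ≤ M₂ ≤ M₃`, `M₁M₂M₃ ≤ x`,
`1 ≤ q ≤ x^{21/41−ε}`, `(t₁t₂t₃, D) = 1` ((4.18)).  Notation (p. 5): `m ≃ M` means that `m` runs over
an arbitrary sub-interval of `]M, 2M]`.
Rendering: the AP modulus is called `s` (it is the smooth modulus of the consumer); `ε` is FIXED
(`2/3 − ε = 3/5`, resp. `21/41 − ε = 1/2 + 1/85`), so the statement reads `∃ δ C₀ C, 0 < δ ∧ ∀ x ≥ 1 …`
(`C₀` absolute and `C = C(ε)` become existential — weaker); sub-intervals of `]Mᵢ, 2Mᵢ]` are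
`Ioc ⌊loᵢ⌋₊ ⌊hiᵢ⌋₊` with `Mᵢ ≤ loᵢ`, `hiᵢ ≤ 2Mᵢ`; classes `mᵢ ≡ tᵢ (mod D)` in `ZMod D`; `(q, aD) = 1`
as `IsCoprime (s : ℤ) (a * D)`; `D ≥ 1`; the signed `≪` as a bound on the absolute value.

Consumers: crux `TypeI2Dilated` of route `Summits/Parity/GeneralizedHardyLittlewood/Theses/
LiouvilleShiftedTables.lean` (line `peel-to-drappeau`, stub `stub_divisorAP`).
-/

open Finset Real

noncomputable section

namespace Literature.NumberTheory.Sieve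

namespace FouvryTenenbaum2021

/-- Fouvry–Tenenbaum's weight `g_q(n; a) = 1_{n ≡ a (mod q)} − 1_{(n, q) = 1}/φ(q)`
(doi:10.1090/tran/8442, §1.1, p. 6), so that `Δ_f(x; q, a) = ∑_{n ≤ x} f(n) g_q(n; a)`; it is
Drappeau's `𝔲_1(n ā; q)` for `(a, q) = 1`. [cite: FouvryTenenbaum2021, §1.1] -/
def gAP (q : ℕ) (a : ℤ) (n : ℕ) : ℝ :=
  (if (n : ZMod q) = (a : ZMod q) then 1 else 0) -
    (if n.Coprime q then 1 else 0) / (Nat.totient q : ℝ)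

/-- `|g_q(n; a)| ≤ 2` (each of the two indicator terms is at most `1`, and `φ(q) ≥ 1` or the
quotient is the junk value `0`). [folklore] -/
theorem abs_gAP_le (q : ℕ) (a : ℤ) (n : ℕ) : |gAP q a n| ≤ 2 := by
  unfold gAP
  have h1 : |(if (n : ZMod q) = (a : ZMod q) then (1 : ℝ) else 0)| ≤ 1 := by
    split_ifs <;> simp
  have h2 : |(if n.Coprime q then (1 : ℝ) else 0) / (Nat.totient q : ℝ)| ≤ 1 := by
    rw [abs_div]
    rcases Nat.eq_zero_or_pos (Nat.totient q) with h | h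
    · simp [h]
    · have hφ : (1 : ℝ) ≤ (Nat.totient q : ℝ) := by exact_mod_cast h
      rw [div_le_one (by positivity)]
      calc |(if n.Coprime q then (1 : ℝ) else 0)| ≤ 1 := by split_ifs <;> simp
        _ ≤ |(Nat.totient q : ℝ)| := by rw [abs_of_nonneg (by positivity)]; exact hφ
  calc |(if (n : ZMod q) = (a : ZMod q) then (1 : ℝ) else 0) -
          (if n.Coprime q then (1 : ℝ) else 0) / (Nat.totient q : ℝ)|
        ≤ |(if (n : ZMod q) = (a : ZMod q) then (1 : ℝ) else 0)| +
          |(if n.Coprime q then (1 : ℝ) else 0) / (Nat.totient q : ℝ)| := abs_sub _ _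
    _ ≤ 1 + 1 := add_le_add h1 h2
    _ = 2 := by norm_num

end FouvryTenenbaum2021

open FouvryTenenbaum2021 in
/-- NAMED FACT — **Fouvry–Tenenbaum 2021, Lemma 4.12, (4.16)** (`τ₂` in arithmetic progressions
beyond `√x` with classes `mod D`; PDF p. 19): "The following statement holds for suitable, absolute
`C₀`. For each `ε > 0`, suitable `δ = δ(ε), c(ε) > 0`, and uniformly for `x ≥ 1`, `M₁, M₂ ≥ 1`,
`Y₀ ≥ 2`, and integers `a, q, t₁, t₂, D`, such that `2 ≤ Y₀ ≤ x^{1/100} ≤ M₁ ≤ M₂`, `M₁M₂ ≤ x`,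
`1 ≤ q ≤ x^{2/3−ε}`, `(q, aD) = 1`, `(t₁t₂, D) = 1`, we have
`∑_{m₁ ≃ M₁, m₂ ≃ M₂, mᵢ ≡ tᵢ (mod D) (i=1,2)} g_q(m₁m₂; a) ≪ D^{C₀} x^{1−δ(ε)}/φ(q)`"
("a classical consequence of Weil's bound for Kloosterman sums", p. 20; `m ≃ M`: `m` in an arbitrary
sub-interval of `]M, 2M]`, p. 5).  Rendered at the fixed exponent `3/5 = 2/3 − 1/15` (so `∃ δ C₀ C`),
the AP modulus being called `s`; see the module docstring.  Not proved here (Weil's bound is not in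
Mathlib) — users take `(h : FouvryTenenbaum2021_lemma412)`. [cite: FouvryTenenbaum2021, Lemma 4.12] -/
def FouvryTenenbaum2021_lemma412 : Prop :=
  ∃ δ C₀ C : ℝ, 0 < δ ∧ ∀ x : ℝ, 1 ≤ x → ∀ M₁ M₂ lo₁ hi₁ lo₂ hi₂ : ℝ,
    x ^ (1 / 100 : ℝ) ≤ M₁ → M₁ ≤ M₂ → M₁ * M₂ ≤ x →
    M₁ ≤ lo₁ → hi₁ ≤ 2 * M₁ → M₂ ≤ lo₂ → hi₂ ≤ 2 * M₂ →
    ∀ (s D : ℕ) (a t₁ t₂ : ℤ), 1 ≤ s → (s : ℝ) ≤ x ^ (3 / 5 : ℝ) → 1 ≤ D →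
      IsCoprime (s : ℤ) (a * D) → IsCoprime (t₁ * t₂) (D : ℤ) →
      |∑ m₁ ∈ (Ioc ⌊lo₁⌋₊ ⌊hi₁⌋₊).filter (fun m : ℕ => (m : ZMod D) = (t₁ : ZMod D)),
          ∑ m₂ ∈ (Ioc ⌊lo₂⌋₊ ⌊hi₂⌋₊).filter (fun m : ℕ => (m : ZMod D) = (t₂ : ZMod D)),
            gAP s a (m₁ * m₂)| ≤
        C * (D : ℝ) ^ C₀ * x ^ (1 - δ) / (Nat.totient s : ℝ)

open FouvryTenenbaum2021 in
/-- NAMED FACT — **Fouvry–Tenenbaum 2021, Lemma 4.13, (4.18)** (`τ₃` in arithmetic progressions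
beyond `√x` with classes `mod D`; PDF p. 19): "The following statement holds for suitable, absolute
`C₀`. For each `ε > 0`, suitable `δ = δ(ε), c(ε) > 0`, and uniformly for `x ≥ 1`, `M₁, M₂, M₃ ≥ 1`,
`Y₀ ≥ 2`, and integers `a, q, t₁, t₂, t₃, D` such that `2 ≤ Y₀ ≤ x^{1/100} ≤ M₁ ≤ M₂ ≤ M₃`,
`M₁M₂M₃ ≤ x`, `1 ≤ q ≤ x^{21/41−ε}`, `(q, aD) = 1`, `(t₁t₂t₃, D) = 1`, we have
`∑_{mᵢ ≃ Mᵢ, mᵢ ≡ tᵢ (mod D) (1≤i≤3)} g_q(m₁m₂m₃; a) ≪ D^{C₀} x^{1−δ(ε)}/φ(q)`" (via Heath-Brown,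
Acta Arith. 47 (1986), Thm 1, after Friedlander–Iwaniec, Ann. of Math. 121 (1985): "any exponent
`< 21/41` is admissible", p. 20).  Rendered at the fixed exponent `1/2 + 1/85 < 21/41` (so `∃ δ C₀ C`),
the AP modulus being called `s`; see the module docstring.  Not proved here (Deligne's bounds) —
users take `(h : FouvryTenenbaum2021_lemma413)`. [cite: FouvryTenenbaum2021, Lemma 4.13] -/
def FouvryTenenbaum2021_lemma413 : Prop :=
  ∃ δ C₀ C : ℝ, 0 < δ ∧ ∀ x : ℝ, 1 ≤ x → ∀ M₁ M₂ M₃ lo₁ hi₁ lo₂ hi₂ lo₃ hi₃ : ℝ,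
    x ^ (1 / 100 : ℝ) ≤ M₁ → M₁ ≤ M₂ → M₂ ≤ M₃ → M₁ * M₂ * M₃ ≤ x →
    M₁ ≤ lo₁ → hi₁ ≤ 2 * M₁ → M₂ ≤ lo₂ → hi₂ ≤ 2 * M₂ → M₃ ≤ lo₃ → hi₃ ≤ 2 * M₃ →
    ∀ (s D : ℕ) (a t₁ t₂ t₃ : ℤ), 1 ≤ s → (s : ℝ) ≤ x ^ (1 / 2 + 1 / 85 : ℝ) → 1 ≤ D →
      IsCoprime (s : ℤ) (a * D) → IsCoprime (t₁ * t₂ * t₃) (D : ℤ) →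
      |∑ m₁ ∈ (Ioc ⌊lo₁⌋₊ ⌊hi₁⌋₊).filter (fun m : ℕ => (m : ZMod D) = (t₁ : ZMod D)),
          ∑ m₂ ∈ (Ioc ⌊lo₂⌋₊ ⌊hi₂⌋₊).filter (fun m : ℕ => (m : ZMod D) = (t₂ : ZMod D)),
            ∑ m₃ ∈ (Ioc ⌊lo₃⌋₊ ⌊hi₃⌋₊).filter (fun m : ℕ => (m : ZMod D) = (t₃ : ZMod D)),
              gAP s a (m₁ * m₂ * m₃)| ≤
        C * (D : ℝ) ^ C₀ * x ^ (1 - δ) / (Nat.totient s : ℝ)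

end Literature.NumberTheory.Sieve

end
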